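import Literature.Geometry.Riemannian.ThreeShrinkerDegenerateLeafFrame
import Literature.Analysis.ODE.ShrinkerLeafProfile
import HarnessLib

/-!
# Degenerate three-dimensional shrinkers: the profile and the Jacobi field along a leaf geodesic

Continuation of `ThreeShrinkerDegenerateLeaves` / `…LeafFrame` (degenerate case of Munteanu–Wang
2016, Thm. 1.2). Fix a complete connected normalised shrinker (`λ = ½`, `S + |∇f|² = f`) of
dimension three with `Ric ≥ 0`, `S > 0` and a null vector of `Ric`, so that `S = C e^{f − h}`
(`ThreeShrinkerDegenerateScalarBound`), and a critical point `p` of `f` on the critical level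
`Σ₀ = {h = 0}` (`ThreeShrinkerDegenerateLeaves.exists_critical_min_max`). For a unit vector `e`
at `p` tangent to the leaf (`κ(e) = 0`) let `γ = γ_e` be the geodesic and `y = f ∘ γ`:

* `H_comp_eq_zero_of_critical` — `h ∘ γ ≡ 0` (`σ₀ = κ₀ = 0` in the quadratic law);
* `profile_hasDerivAt` — **the profile equation** `y'' = ½ − (C/2) eʸ` with `y'(0) = 0`
  (`(df(γ̇))' = λ − S/2`, `S ∘ γ = C e^{y}`), and the **energy identity** `y'² = y − C eʸ`
  (`f = S` at the critical point, `ShrinkerLeafProfile.sq_deriv_eq_of_profile`);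
* `jacobi_along_leaf` — **the Jacobi field `J` of the variation `γ_{e + s n₀}`** (`J(0) = 0`,
  `D_tJ(0) = n₀`, `n₀` a unit leaf vector orthogonal to `e`) **is `(y'/a) n`**, `a = ½ − S(p)/2`,
  with `D_t J = (y''/a) n`, for the parallel transport `n` of `n₀`: in the parallel orthonormal
  frame `(γ̇, n, ν)` (`ν` the transport of the unit null vector at `p`, which stays null,
  `…LeafFrame.kappa_parallel_eq`) the curvature matrix is `diag(S/2, 0)`
  (`…LeafFrame.curvature_frame_of_null`), so the components `g(J, n)`, `g(J, ν)` solve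
  `α'' = −(C/2)e^{y} α`, `β'' = 0` with data `(0, 1)`, `(0, 0)`
  (`ShrinkerLeafProfile.jacobi_eq_deriv_div_Ioo`).

Everything is proved; no definitions are introduced.

## References

* O. Munteanu, J. Wang, arXiv:1606.01861, Thm. 1.2 (p. 3). [MunteanuWang2016]
* R. S. Hamilton, *The Ricci flow on surfaces*, Contemp. Math. 71 (1988), §10. [Hamilton1988]
* I. Chavel, *Riemannian geometry*, 2nd ed. 2006, §III.1. [Chavel2006]
-/

noncomputable section

set_option maxSynthPendingDepth 3

open Bundle Set Function Filter Module Metric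
open scoped Manifold ContDiff Topology NNReal

namespace Literature.Geometry.Riemannian

open Lorentzian Lorentzian.PseudoRiemannianMetric
open Literature.Analysis.ODE.ShrinkerLeafProfile

variable {M : Type*} [TopologicalSpace M] [ChartedSpace (EuclideanSpace ℝ (Fin 3)) M]
  [IsManifold (𝓡 3) ∞ M]
  (g : PseudoRiemannianMetric (𝓡 3) ∞ (EuclideanSpace ℝ (Fin 3)) (TangentSpace (𝓡 3) : M → Type _))
  [g.HasLeviCivita]

namespace DegenerateShrinker

section Along

variable [T2Space M] [ConnectedSpace M]
  -- `hg : g.IsRiemannian`, unfolded (positive definiteness on every tangent space)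
  (hg : ∀ (x : M) (v : TangentSpace (𝓡 3) x), v ≠ 0 → 0 < g.val x v v)
  {f : M → ℝ} (hf : ContMDiff (𝓡 3) 𝓘(ℝ, ℝ) ∞ f) {lam : ℝ}
  (hsol : ∀ (x : M) (X Y : TangentSpace (𝓡 3) x),
    g.ricci x X Y + g.hessian f x X Y = lam * g.val x X Y)
  (hRic0 : ∀ (x : M) (w : TangentSpace (𝓡 3) x), 0 ≤ g.ricci x w w)
  (hS : ∀ x, 0 < g.scalarCurvature x) {p₀ : M} {w₀ : TangentSpace (𝓡 3) p₀} (hw₀ : w₀ ≠ 0)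
  (hnull : g.ricci p₀ w₀ w₀ = 0)
  {gradf : (x : M) → TangentSpace (𝓡 3) x}
  (hgradf : ∀ x, gradf x = g.sharp x (mvfderiv (𝓡 3) f x : TangentSpace (𝓡 3) x →ₗ[ℝ] ℝ))
  {H : M → ℝ}
  (hH : ∀ x, H x = g.gradSq f x - 2 / g.scalarCurvature x * g.ricci x (gradf x) (gradf x))
  {κ : (x : M) → TangentSpace (𝓡 3) x → ℝ}
  (hκ : ∀ (x : M) (w : TangentSpace (𝓡 3) x),
    κ x w = g.val x w w - 2 / g.scalarCurvature x * g.ricci x w w)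
  {σ : (x : M) → TangentSpace (𝓡 3) x → ℝ}
  (hσ : ∀ (x : M) (w : TangentSpace (𝓡 3) x),
    σ x w = mvfderiv (𝓡 3) f x w - 2 / g.scalarCurvature x * g.ricci x (gradf x) w)
include hg hf hsol hRic0 hS hw₀ hnull

set_option hygiene false in
/-- Shorthand for the leaf geodesic `γ_e = maximalGeodesic g.leviCivita p e` in the proofs below
(unhygienic: `p`, `e` are the binders of the theorem at hand). -/
local notation "γₑ" => maximalGeodesic g.leviCivita p e

/-! ### `h` vanishes along leaf geodesics from a critical point of `Σ₀` -/

include hgradf hH hκ hσ in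
/-- **`h ∘ γ_e ≡ 0`** for a geodesic issuing from a critical point `p ∈ Σ₀` of `f` in a leaf
direction `e` (`κ(e) = 0`): in the quadratic law `σ₀ = df(e) − (2/S)Ric(∇f, e) = 0` (`df_p = 0`)
and `κ₀ = 0`. [cite: MunteanuWang2016, Thm. 1.2] -/
theorem H_comp_eq_zero_of_critical (hc : IsGeodesicallyComplete g.leviCivita) {p : M}
    (hp : H p = 0) (hdf : mvfderiv (𝓡 3) f p = 0) {e : TangentSpace (𝓡 3) p} (he : κ p e = 0)
    (t : ℝ) : H (maximalGeodesic g.leviCivita p e t) = 0 := by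
  haveI := contMDiffCovariantDerivative_leviCivita_one g
  obtain ⟨-, hgeo, hγ0, hγe⟩ := maximalGeodesic_of_isGeodesicallyComplete hc p e
  have h := H_comp_geodesic_eq g hg hf hsol hRic0 hS hw₀ hnull hgradf hH hκ hσ hgeo t
  have hb : maximalGeodesic g.leviCivita p e 0 = p := hγ0
  rw [hγe, hb, hp, hσ, hgradf, hdf, he] at h
  simpa using h

/-! ### The profile `y = f ∘ γ` -/

include hgradf hH hκ hσ in
/-- **The profile equation** along a unit leaf geodesic from a critical point of `Σ₀` of a
normalised degenerate shrinker with `S = C e^{f − h}`: `y' = df(γ̇)`, `(df(γ̇))' = ½ − (C/2)eʸ`,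
`y'(0) = 0`, `½ − (C/2)e^{y(0)} = ½ − S(p)/2`.
[cite: Hamilton1988, §10] [cite: MunteanuWang2016, Thm. 1.2] -/
theorem profile_hasDerivAt (hlam : lam = 1 / 2) (hc : IsGeodesicallyComplete g.leviCivita)
    {C : ℝ} (hSC : ∀ x, g.scalarCurvature x = C * Real.exp (f x - H x)) {p : M}
    (hp : H p = 0) (hdf : mvfderiv (𝓡 3) f p = 0) {e : TangentSpace (𝓡 3) p}
    (hee : g.val p e e = 1) (he : κ p e = 0) :
    (∀ t, HasDerivAt (fun s ↦ f (maximalGeodesic g.leviCivita p e s))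
      (mvfderiv (𝓡 3) f (maximalGeodesic g.leviCivita p e t)
        (velocity (𝓡 3) γₑ t)) t) ∧
    (∀ t, HasDerivAt (fun s ↦ mvfderiv (𝓡 3) f (maximalGeodesic g.leviCivita p e s)
        (velocity (𝓡 3) γₑ s))
      (1 / 2 - C / 2 * Real.exp (f (maximalGeodesic g.leviCivita p e t))) t) ∧
    mvfderiv (𝓡 3) f (maximalGeodesic g.leviCivita p e 0)
        (velocity (𝓡 3) γₑ 0) = 0 ∧
    1 / 2 - C / 2 * Real.exp (f (maximalGeodesic g.leviCivita p e 0)) =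
      1 / 2 - g.scalarCurvature p / 2 := by
  subst hlam
  haveI := contMDiffCovariantDerivative_leviCivita_one g
  have hLC := PseudoRiemannianMetric.isLeviCivita_leviCivita_holds (g := g)
  obtain ⟨-, hgeo, hγ0, hγe⟩ := maximalGeodesic_of_isGeodesicallyComplete hc p e
  have hb : maximalGeodesic g.leviCivita p e 0 = p := hγ0
  have hH0 := H_comp_eq_zero_of_critical g hg hf hsol hRic0 hS hw₀ hnull hgradf hH hκ hσ hc hp hdf
    he
  refine ⟨fun t ↦ hasDerivAt_f g hg hf hsol hRic0 hS hw₀ hnull hgeo t, fun t ↦ ?_, ?_, ?_⟩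
  · have h := hasDerivAt_mvfderiv_velocity g hg hf hsol hRic0 hS hw₀ hnull hκ hgeo t
    have hspeed : g.val (maximalGeodesic g.leviCivita p e t)
        (velocity (𝓡 3) γₑ t)
        (velocity (𝓡 3) γₑ t) = 1 := by
      rw [g.val_velocity_eq_of_isGeodesicOn_of_isCompatible hLC.2 isOpen_univ
        Set.ordConnected_univ hgeo (mem_univ t) (mem_univ 0), hγe, hb]
      exact hee
    have hkap : κ (maximalGeodesic g.leviCivita p e t)
        (velocity (𝓡 3) γₑ t) = 0 := by
      rw [kappa_velocity_eq g hg hf hsol hRic0 hS hw₀ hnull hκ hgeo t, hγe, hb]; exact he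
    rw [hspeed, hkap, hSC, hH0 t, sub_zero] at h
    refine h.congr_deriv ?_
    ring
  · rw [hγe, hb]; exact DFunLike.congr_fun hdf e
  · rw [hb, hSC p, hp, sub_zero]; ring

include hgradf hH hκ hσ in
/-- **The energy identity of the profile**: with `f(p) = S(p)` at the critical point,
`(df(γ̇))² = y − C eʸ` along the leaf geodesic. [cite: Hamilton1988, §10] -/
theorem profile_energy (hlam : lam = 1 / 2) (hc : IsGeodesicallyComplete g.leviCivita)
    {C : ℝ} (hSC : ∀ x, g.scalarCurvature x = C * Real.exp (f x - H x)) {p : M}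
    (hp : H p = 0) (hdf : mvfderiv (𝓡 3) f p = 0) (hfS : f p = g.scalarCurvature p)
    {e : TangentSpace (𝓡 3) p} (hee : g.val p e e = 1) (he : κ p e = 0) (t : ℝ) :
    (mvfderiv (𝓡 3) f (maximalGeodesic g.leviCivita p e t)
        (velocity (𝓡 3) γₑ t)) ^ 2 =
      f (maximalGeodesic g.leviCivita p e t) -
        C * Real.exp (f (maximalGeodesic g.leviCivita p e t)) := by
  obtain ⟨hY, hY₁, h0, -⟩ := profile_hasDerivAt g hg hf hsol hRic0 hS hw₀ hnull hgradf hH hκ hσ hlam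
    hc hSC hp hdf hee he
  haveI := contMDiffCovariantDerivative_leviCivita_one g
  have hb : maximalGeodesic g.leviCivita p e 0 = p :=
    (maximalGeodesic_of_isGeodesicallyComplete hc p e).2.2.1
  refine sq_deriv_eq_of_profile hY hY₁ ?_ t
  rw [h0, hb]
  have h1 := hSC p
  rw [hp, sub_zero] at h1
  rw [← h1, hfS]; ring

/-! ### The Jacobi field along a leaf geodesic -/

set_option maxHeartbeats 800000 in
include hgradf hH hκ hσ in
/-- **The Jacobi field of the variation `s ↦ γ_{e + s n₀}` along a leaf geodesic is
`(y'/a) n`.** Let `p ∈ Σ₀` be a critical point of `f` with `f(p) = S(p)` on a complete normalised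
degenerate shrinker with `S = C e^{f−h}`, `(e, n₀, ν₀)` orthonormal at `p` with `Ric(ν₀, ν₀) = 0`
(so `e, n₀` span the leaf plane), and `a = ½ − S(p)/2 ≠ 0`. Then for every `T > 0` there is a unit
leaf field `n` along `γ_e` on `(−T, T)`, orthogonal to `γ̇`, with `J = (df(γ̇)/a) n` and
`D_t J = ((½ − (C/2)e^{f∘γ})/a) n` there, `J(t) = ∂_s|₀ γ_{e+sn₀}(t)` the Jacobi field with
`J(0) = 0`, `D_tJ(0) = n₀` (the parallel transport of `n₀`).
[cite: MunteanuWang2016, Thm. 1.2] [cite: Hamilton1988, §10] [cite: Chavel2006, §III.1] -/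
theorem jacobi_along_leaf (hlam : lam = 1 / 2) (hc : IsGeodesicallyComplete g.leviCivita)
    {C : ℝ} (hSC : ∀ x, g.scalarCurvature x = C * Real.exp (f x - H x)) {p : M}
    (hp : H p = 0) (hdf : mvfderiv (𝓡 3) f p = 0) {e n₀ ν₀ : TangentSpace (𝓡 3) p}
    (hee : g.val p e e = 1) (hnn : g.val p n₀ n₀ = 1) (hνν : g.val p ν₀ ν₀ = 1)
    (hen : g.val p e n₀ = 0) (heν : g.val p e ν₀ = 0) (hnν : g.val p n₀ ν₀ = 0)
    (hν : g.ricci p ν₀ ν₀ = 0) {a : ℝ} (ha : a = 1 / 2 - g.scalarCurvature p / 2) (ha0 : a ≠ 0)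
    {T : ℝ} (hT : 0 < T) :
    ∃ n : Π t : ℝ, TangentSpace (𝓡 3) (maximalGeodesic g.leviCivita p e t),
      (∀ t ∈ Ioo (-T) T, g.val (maximalGeodesic g.leviCivita p e t) (n t) (n t) = 1 ∧
        g.val (maximalGeodesic g.leviCivita p e t)
          (velocity (𝓡 3) γₑ t) (n t) = 0 ∧
        κ (maximalGeodesic g.leviCivita p e t) (n t) = 0) ∧
      ∀ t ∈ Ioo (-T) T,
        velocity (𝓡 3) (fun s' : ℝ ↦ maximalGeodesic g.leviCivita p (e + s' • n₀) t) 0 =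
          (mvfderiv (𝓡 3) f (maximalGeodesic g.leviCivita p e t)
            (velocity (𝓡 3) γₑ t) / a) • n t ∧
        covariantDerivAlong g.leviCivita γₑ
            (fun t ↦ velocity (𝓡 3)
              (fun s' : ℝ ↦ maximalGeodesic g.leviCivita p (e + s' • n₀) t) 0) t =
          ((1 / 2 - C / 2 * Real.exp (f (maximalGeodesic g.leviCivita p e t))) / a) • n t := by
  haveI := contMDiffCovariantDerivative_leviCivita_one g
  haveI := contMDiffCovariantDerivative_leviCivita_infty g le_rfl
  have hLC := PseudoRiemannianMetric.isLeviCivita_leviCivita_holds (g := g)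
  have hn2 : (2 : ℕ∞ω) ≤ ∞ := WithTop.coe_le_coe.2 le_top
  have hreg : g.leviCivita.IsLocallyContMDiff 1 := hLC.isLocallyContMDiff_one hn2
  obtain ⟨-, hgeo, hγ0, hγe⟩ := maximalGeodesic_of_isGeodesicallyComplete hc p e
  have hb : maximalGeodesic g.leviCivita p e 0 = p := hγ0
  have hsymm := g.symm p
  -- `e`, `n₀` are leaf vectors (`κ = g(ν₀, ·)²`), `κ(ν₀) = 1`
  have hκν : κ p ν₀ = 1 := by rw [hκ, hνν, hν, mul_zero, sub_zero]
  have he : κ p e = 0 := by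
    rw [kappa_eq_sq_of_unit_null g hg hf hsol hRic0 hS hw₀ hnull hκ hνν hν e, hsymm ν₀ e, heν]
    ring
  -- the profile
  obtain ⟨hY, hY₁, hY₁0, haY⟩ := profile_hasDerivAt g hg hf hsol hRic0 hS hw₀ hnull hgradf hH hκ hσ
    hlam hc hSC hp hdf hee he
  have hH0 := H_comp_eq_zero_of_critical g hg hf hsol hRic0 hS hw₀ hnull hgradf hH hκ hσ hc hp hdf
    he
  -- the Jacobi field
  obtain ⟨hJac, hJ0, hDJ0, hJd, hDJd⟩ := jacobiField_geodesicVariation g hreg hc p e n₀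
  have he0 : e + (0 : ℝ) • n₀ = e := by rw [zero_smul, add_zero]
  rw [he0] at hJac hJ0 hDJ0 hJd hDJd
  -- the parallel orthonormal frame `(γ̇, n, ν)` on `(−T, T)`
  have h0I : (0 : ℝ) ∈ Ioo (-T) T := ⟨by linarith, hT⟩
  set wfr : Option (Fin 2) → TangentSpace (𝓡 3) (maximalGeodesic g.leviCivita p e 0) := fun o ↦
    o.elim (velocity (𝓡 3) γₑ 0)
      (fun i ↦ (![n₀, ν₀] : Fin 2 → EuclideanSpace ℝ (Fin 3)) i) with hwfr
  have hw : ∀ i j, g.val (maximalGeodesic g.leviCivita p e 0) (wfr i) (wfr j) =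
      if i = j then 1 else 0 := by
    intro i j
    rcases i with _ | i <;> rcases j with _ | j
    · simp only [hwfr, Option.elim_none, if_true]
      rw [hγe, hb]; exact hee
    · simp only [hwfr, Option.elim_none, Option.elim_some, reduceCtorEq, if_false]
      rw [hγe, hb]
      fin_cases j
      · exact hen
      · exact heν
    · simp only [hwfr, Option.elim_none, Option.elim_some, reduceCtorEq, if_false]
      rw [hγe, hb]
      fin_cases i
      · rw [hsymm]; exact hen
      · rw [hsymm]; exact heν
    · simp only [hwfr, Option.elim_some, Option.some.injEq]
      rw [hb]
      fin_cases i <;> fin_cases j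
      · simpa using hnn
      · simpa using hnν
      · simpa [hsymm n₀ ν₀] using hnν
      · simpa using hνν
  obtain ⟨Efr, hE0, hEpar, hEon⟩ :=
    exists_parallel_orthonormal_frame_maximalGeodesic g hg hc p e h0I wfr hw
  set J : Π t : ℝ, TangentSpace (𝓡 3) (γₑ t) := fun t ↦
    velocity (𝓡 3) (fun s' : ℝ ↦ maximalGeodesic g.leviCivita p (e + s' • n₀) t) 0 with hJdef
  set n : Π t : ℝ, TangentSpace (𝓡 3) (γₑ t) := Efr (some 0) with hndef
  set ν : Π t : ℝ, TangentSpace (𝓡 3) (γₑ t) := Efr (some 1) with hνdef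
  have hn0 : n 0 = n₀ := by rw [hndef, hE0]; rfl
  have hν0 : ν 0 = ν₀ := by rw [hνdef, hE0]; rfl
  -- the transported head is `γ̇`
  have hvelpar : IsParallelAlongOn g.leviCivita γₑ (fun t ↦ velocity (𝓡 3) γₑ t) (Ioo (-T) T) :=
    (IsGeodesicOn.isParallelAlongOn_velocity hgeo).mono (subset_univ _)
  have hEnone : ∀ t ∈ Ioo (-T) T, Efr none t = velocity (𝓡 3) γₑ t := fun t ht ↦
    eq_of_isParallelAlongOn g hg hLC.2 (ordConnected_Ioo) (hEpar none) hvelpar h0I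
      (by rw [hE0]; rfl) ht
  -- orthonormality relations on the interval
  have hnn' : ∀ t ∈ Ioo (-T) T, g.val (γₑ t) (n t) (n t) = 1 := fun t ht ↦ by
    have := hEon t ht (some 0) (some 0); simpa using this
  have hνν' : ∀ t ∈ Ioo (-T) T, g.val (γₑ t) (ν t) (ν t) = 1 := fun t ht ↦ by
    have := hEon t ht (some 1) (some 1); simpa using this
  have hnν' : ∀ t ∈ Ioo (-T) T, g.val (γₑ t) (n t) (ν t) = 0 := fun t ht ↦ by
    have := hEon t ht (some 0) (some 1); simpa using this
  have huu' : ∀ t ∈ Ioo (-T) T, g.val (γₑ t) (velocity (𝓡 3) γₑ t) (velocity (𝓡 3) γₑ t) = 1 :=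
    fun t ht ↦ by have := hEon t ht none none; rw [hEnone t ht] at this; simpa using this
  have hun' : ∀ t ∈ Ioo (-T) T, g.val (γₑ t) (velocity (𝓡 3) γₑ t) (n t) = 0 :=
    fun t ht ↦ by have := hEon t ht none (some 0); rw [hEnone t ht] at this; simpa using this
  have huν' : ∀ t ∈ Ioo (-T) T, g.val (γₑ t) (velocity (𝓡 3) γₑ t) (ν t) = 0 :=
    fun t ht ↦ by have := hEon t ht none (some 1); rw [hEnone t ht] at this; simpa using this
  -- `ν` stays null
  have hνnull : ∀ t ∈ Ioo (-T) T, g.ricci (γₑ t) (ν t) (ν t) = 0 := by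
    intro t ht
    have hk : κ (γₑ t) (ν t) = 1 := by
      rw [kappa_parallel_eq g hg hf hsol hRic0 hS hw₀ hnull hκ hgeo (hEpar (some 1)) ht h0I]
      change κ (γₑ 0) (ν 0) = 1
      rw [hν0, hb]
      exact hκν
    rw [ricci_eq_of_kappa g hS hκ, hνν' t ht, hk, sub_self, mul_zero]
  -- the curvature matrix in the frame `(n, ν)` is `diag(S/2, 0)`
  have hR : ∀ t ∈ Ioo (-T) T,
      g.val (γₑ t) (g.riemann (γₑ t) (n t) (velocity (𝓡 3) γₑ t) (velocity (𝓡 3) γₑ t)) (n t) =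
        g.scalarCurvature (γₑ t) / 2 ∧
      g.val (γₑ t) (g.riemann (γₑ t) (ν t) (velocity (𝓡 3) γₑ t) (velocity (𝓡 3) γₑ t)) (n t) = 0 ∧
      g.val (γₑ t) (g.riemann (γₑ t) (n t) (velocity (𝓡 3) γₑ t) (velocity (𝓡 3) γₑ t)) (ν t) = 0 ∧
      g.val (γₑ t) (g.riemann (γₑ t) (ν t) (velocity (𝓡 3) γₑ t) (velocity (𝓡 3) γₑ t)) (ν t) = 0 :=
    fun t ht ↦ curvature_frame_of_null g hg hf hsol hRic0 hS hw₀ hnull (huu' t ht) (hnn' t ht)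
      (hνν' t ht) (hun' t ht) (huν' t ht) (hnν' t ht) (hνnull t ht)
  -- `J ⊥ γ̇`, `D_t J ⊥ γ̇`, and the expansions of `J`, `D_t J` in `(n, ν)`
  have hperp := val_velocity_eq_zero_of_isJacobiFieldAlongOn g hreg hn2 hgeo hJac hJd hDJd
    (by
      change g.val (γₑ 0) (velocity (𝓡 3)
        (fun s' : ℝ ↦ maximalGeodesic g.leviCivita p (e + s' • n₀) 0) 0) (velocity (𝓡 3) γₑ 0) = 0
      rw [hJ0, map_zero, _root_.zero_apply])
    (by rw [hDJ0, hγe, hb, hsymm]; exact hen)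
  have hcard : Fintype.card (Option (Fin 2)) = finrank ℝ (EuclideanSpace ℝ (Fin 3)) := by simp
  have hframe : ∀ t ∈ Ioo (-T) T, ∀ o o', g.val (γₑ t)
      ((fun o : Option (Fin 2) ↦ o.elim (velocity (𝓡 3) γₑ t) (fun i ↦ Efr (some i) t)) o)
      ((fun o : Option (Fin 2) ↦ o.elim (velocity (𝓡 3) γₑ t) (fun i ↦ Efr (some i) t)) o') =
        if o = o' then 1 else 0 := by
    intro t ht o o'
    have h := hEon t ht o o'
    rcases o with _ | i <;> rcases o' with _ | j
    · simpa [hEnone t ht] using h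
    · simpa [hEnone t ht] using h
    · simpa [hEnone t ht] using h
    · simpa using h
  have hexpJ : ∀ t ∈ Ioo (-T) T, J t = ∑ i : Fin 2, g.val (γₑ t) (J t) (Efr (some i) t) •
      Efr (some i) t := fun t ht ↦
    eq_sum_normal_of_val_eq_zero g (γₑ t) (hframe t ht) hcard (hperp t).1
  have hexpDJ : ∀ t ∈ Ioo (-T) T, covariantDerivAlong g.leviCivita γₑ J t =
      ∑ i : Fin 2, g.val (γₑ t) (covariantDerivAlong g.leviCivita γₑ J t) (Efr (some i) t) •
        Efr (some i) t := fun t ht ↦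
    eq_sum_normal_of_val_eq_zero g (γₑ t) (hframe t ht) hcard (hperp t).2
  -- the components `α = g(J, n)`, `β = g(J, ν)` and their equations
  have hαd : ∀ t ∈ Ioo (-T) T, HasDerivAt (fun t ↦ g.val (γₑ t) (J t) (n t))
      (g.val (γₑ t) (covariantDerivAlong g.leviCivita γₑ J t) (n t)) t := fun t ht ↦
    hasDerivAt_val_apply_of_isParallelAlongOn g hLC.2 (hJd t) (hEpar (some 0)) ht
  have hβd : ∀ t ∈ Ioo (-T) T, HasDerivAt (fun t ↦ g.val (γₑ t) (J t) (ν t))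
      (g.val (γₑ t) (covariantDerivAlong g.leviCivita γₑ J t) (ν t)) t := fun t ht ↦
    hasDerivAt_val_apply_of_isParallelAlongOn g hLC.2 (hJd t) (hEpar (some 1)) ht
  have hSt : ∀ t, g.scalarCurvature (γₑ t) = C * Real.exp (f (γₑ t)) := fun t ↦ by
    rw [hSC, hH0 t, sub_zero]
  have hJacI : IsJacobiFieldAlongOn g γₑ J (Ioo (-T) T) := fun t _ ↦ hJac t (mem_univ t)
  have hα₁d : ∀ t ∈ Ioo (-T) T,
      HasDerivAt (fun t ↦ g.val (γₑ t) (covariantDerivAlong g.leviCivita γₑ J t) (n t))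
        (-(C / 2 * Real.exp (f (γₑ t))) * g.val (γₑ t) (J t) (n t)) t := by
    intro t ht
    have h := hasDerivAt_val_covariantDerivAlong_frame_of_expansion g hJacI (hDJd t)
      (e := fun i ↦ Efr (some i)) (fun i ↦ hEpar (some i)) ht (hexpJ t ht) 0
    obtain ⟨r1, r2, -, -⟩ := hR t ht
    refine h.congr_deriv ?_
    rw [Fin.sum_univ_two]
    change -(g.val (γₑ t) (g.riemann (γₑ t) (n t) (velocity (𝓡 3) γₑ t) (velocity (𝓡 3) γₑ t))
        (n t) * g.val (γₑ t) (J t) (n t) +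
      g.val (γₑ t) (g.riemann (γₑ t) (ν t) (velocity (𝓡 3) γₑ t) (velocity (𝓡 3) γₑ t)) (n t) *
        g.val (γₑ t) (J t) (ν t)) = _
    rw [r1, r2, hSt t]
    ring
  have hβ₁d : ∀ t ∈ Ioo (-T) T,
      HasDerivAt (fun t ↦ g.val (γₑ t) (covariantDerivAlong g.leviCivita γₑ J t) (ν t)) 0 t := by
    intro t ht
    have h := hasDerivAt_val_covariantDerivAlong_frame_of_expansion g hJacI (hDJd t)
      (e := fun i ↦ Efr (some i)) (fun i ↦ hEpar (some i)) ht (hexpJ t ht) 1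
    obtain ⟨-, -, r3, r4⟩ := hR t ht
    refine h.congr_deriv ?_
    rw [Fin.sum_univ_two]
    change -(g.val (γₑ t) (g.riemann (γₑ t) (n t) (velocity (𝓡 3) γₑ t) (velocity (𝓡 3) γₑ t))
        (ν t) * g.val (γₑ t) (J t) (n t) +
      g.val (γₑ t) (g.riemann (γₑ t) (ν t) (velocity (𝓡 3) γₑ t) (velocity (𝓡 3) γₑ t)) (ν t) *
        g.val (γₑ t) (J t) (ν t)) = _
    rw [r3, r4]
    ring
  -- initial data
  have hJ0' : J 0 = 0 := hJ0
  have hα0 : g.val (γₑ 0) (J 0) (n 0) = 0 := by rw [hJ0', map_zero, _root_.zero_apply]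
  have hβ0 : g.val (γₑ 0) (J 0) (ν 0) = 0 := by rw [hJ0', map_zero, _root_.zero_apply]
  have hα₁0 : g.val (γₑ 0) (covariantDerivAlong g.leviCivita γₑ J 0) (n 0) = 1 := by
    rw [hDJ0, hn0, hb]; exact hnn
  have hβ₁0 : g.val (γₑ 0) (covariantDerivAlong g.leviCivita γₑ J 0) (ν 0) = 0 := by
    rw [hDJ0, hν0, hb]; exact hnν
  -- `β ≡ 0`
  have hβ₁z : ∀ t ∈ Ioo (-T) T, g.val (γₑ t) (covariantDerivAlong g.leviCivita γₑ J t) (ν t) = 0 :=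
    fun t ht ↦ by
    rw [← hβ₁0]
    exact isOpen_Ioo.is_const_of_deriv_eq_zero (convex_Ioo (-T) T).isPreconnected
      (fun s hs ↦ (hβ₁d s hs).differentiableAt.differentiableWithinAt)
      (fun s hs ↦ (hβ₁d s hs).deriv) ht h0I
  have hβz : ∀ t ∈ Ioo (-T) T, g.val (γₑ t) (J t) (ν t) = 0 := fun t ht ↦ by
    rw [← hβ0]
    exact isOpen_Ioo.is_const_of_deriv_eq_zero (convex_Ioo (-T) T).isPreconnected
      (fun s hs ↦ (hβd s hs).differentiableAt.differentiableWithinAt)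
      (fun s hs ↦ by
        show deriv (fun t ↦ g.val (γₑ t) (J t) (ν t)) s = 0
        rw [(hβd s hs).deriv, hβ₁z s hs]) ht h0I
  -- `α = y'/a`, `α₁ = y''/a`
  have hY₁0' : (fun s ↦ mvfderiv (𝓡 3) f (γₑ s) (velocity (𝓡 3) γₑ s)) 0 = 0 := hY₁0
  have hjac := fun t (ht : t ∈ Ioo (-T) T) ↦ jacobi_eq_deriv_div_Ioo (C := C) (a₀ := a) hY hY₁
    hY₁0' (by rw [haY, ha]) ha0 hαd hα₁d hα0 hα₁0 h0I ht
  have hκn : ∀ t ∈ Ioo (-T) T, κ (γₑ t) (n t) = 0 := fun t ht ↦ by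
    rw [kappa_parallel_eq g hg hf hsol hRic0 hS hw₀ hnull hκ hgeo (hEpar (some 0)) ht h0I]
    change κ (γₑ 0) (n 0) = 0
    rw [hn0, hb, kappa_eq_sq_of_unit_null g hg hf hsol hRic0 hS hw₀ hnull hκ hνν hν n₀, hsymm ν₀ n₀,
      hnν]
    ring
  refine ⟨n, fun t ht ↦ ⟨hnn' t ht, hun' t ht, hκn t ht⟩, fun t ht ↦ ?_⟩
  obtain ⟨hj, hj₁⟩ := hjac t ht
  refine ⟨?_, ?_⟩
  · -- `J = α n + β ν = (y'/a) n`
    have h := hexpJ t ht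
    rw [Fin.sum_univ_two] at h
    change J t = g.val (γₑ t) (J t) (n t) • n t + g.val (γₑ t) (J t) (ν t) • ν t at h
    rw [hβz t ht, zero_smul, add_zero] at h
    change J t = _
    rw [h]
    exact congrArg (· • n t) hj
  · have h := hexpDJ t ht
    rw [Fin.sum_univ_two] at h
    change covariantDerivAlong g.leviCivita γₑ J t =
      g.val (γₑ t) (covariantDerivAlong g.leviCivita γₑ J t) (n t) • n t +
        g.val (γₑ t) (covariantDerivAlong g.leviCivita γₑ J t) (ν t) • ν t at h
    rw [hβ₁z t ht, zero_smul, add_zero] at h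
    change covariantDerivAlong g.leviCivita γₑ J t = _
    rw [h]
    exact congrArg (· • n t) hj₁

end Along

end DegenerateShrinker

end Literature.Geometry.Riemannian

end
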